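import Mathlib
import Summits.ValiantsHypothesis.ValiantsHypothesis.Theorems.FifoMatchingNFPolytopeQueueGridGadgetWindows
import Summits.ValiantsHypothesis.ValiantsHypothesis.Theorems.FifoMatchingNFPolytopeQueueGridGadgetCounts
import Summits.ValiantsHypothesis.ValiantsHypothesis.Theorems.FifoMatchingNFPolytopeQueueGridGadgetDesigns
import HarnessLib

/-!
# Route `FifoMatching`, item `NFPolytopeQuasiPolyXC` (K1, stmt-26254), line `queue_grid_face`, INPUT (A):
# RIGIDITY of the layout-B face — every nest-free perfect matching supported on `E′` is a design

Let `M` be a nest-free perfect matching of `Fin (2 · half r d)` with every arc in `allowed r d`.  Then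
(`forced letters`) preamble letters, frame `U`s and even padding letters are openers, frame `D`s, postamble letters and
odd padding letters are closers; (`windows_ok`, induction on the stretch through the feeding lemma
`window_pattern`) every window reads `UUDD` or `DDUU`; hence the openers of `M` are exactly the pushes of the design word
of the bit matrix `bitsOf M (s,i) = [slot 0 of window (s,i) is an opener]` (`lt_iff_isU_bitsOf`), and by the uniqueness
of a nest-free perfect matching with given openers (c1 g5's F-B `eq_of_forall_lt_iff`) `M = design d (bitsOf M)`
(`design_bitsOf`, **h3** of the face-projection interface `face_projection_of_gadget_prop`).
Honest framing: a step of input (A); K1 stays open; VP ≠ VNP is NOT proved by anything here.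
-/

noncomputable section

-- Sub = Summit single-conjunct layout: the duplicated namespace component is mandated by the tree.
set_option linter.dupNamespace false

namespace Summit.ValiantsHypothesis.ValiantsHypothesis.Theorems.FifoMatching.NFPolytopeQuasiPolyXC.QueueGridFace

open Finset Literature.Computability.AlgebraicComplexity
open Summit.ValiantsHypothesis.ValiantsHypothesis.Theorems.FifoMatching.QueueGridFace

namespace QPos

variable {r d : ℕ}

/-! ### Positions without incoming / outgoing allowed arcs -/

/-- no allowed arc ends at a preamble letter -/
theorem adj_pre_right (z : QPos r d) (j : Fin (2 * r + 1)) : adj z (pre j) = false := by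
  rw [Bool.eq_false_iff]; intro h
  obtain ⟨-, hV⟩ := adjV_of_adj' h (by simp only [vc_pre]; omega)
  simp only [adjV_eq_true_iff, vc_pre] at hV
  omega

/-- no allowed arc ends at a frame `U` -/
theorem adj_frU_right (z : QPos r d) (s : Fin r) : adj z (frU s) = false := by
  rw [Bool.eq_false_iff]; intro h
  have hs := s.isLt
  obtain ⟨-, hV⟩ := adjV_of_adj' h (by simp only [vc_frU]; omega)
  have hz := vc_spec z
  simp only [adjV_eq_true_iff, vc_frU] at hV
  omega

/-- no allowed arc starts at a frame `D` -/
theorem adj_frD_left (s : Fin r) (z : QPos r d) : adj (frD s) z = false := by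
  rw [Bool.eq_false_iff]; intro h
  have hs := s.isLt
  obtain ⟨hz1, hV⟩ := adjV_of_adj h (by simp only [vc_frD]; omega)
  have hz := vc_spec z
  simp only [adjV_eq_true_iff, vc_frD] at hV
  omega

/-- no allowed arc starts at a postamble letter -/
theorem adj_post_left (j : Fin (2 * r + 1)) (z : QPos r d) : adj (post j) z = false := by
  rw [Bool.eq_false_iff]; intro h
  obtain ⟨hz1, hV⟩ := adjV_of_adj h (by simp only [vc_post]; omega)
  simp only [adjV_eq_true_iff, vc_post] at hV
  omega

/-- no allowed arc ends at an even padding letter -/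
theorem adj_pad_even_right (z : QPos r d) (j : Fin (2 * d)) (hj : j.val % 2 = 0) : adj z (pad j) = false := by
  rw [Bool.eq_false_iff]; intro h
  rcases (adj_eq_true_iff z (pad j)).1 h with ⟨j₀, j', -, hj', hj₀, hjj⟩ | ⟨-, hne, -⟩
  · cases hj'; omega
  · exact hne j rfl

/-- no allowed arc starts at an odd padding letter -/
theorem adj_pad_odd_left (j : Fin (2 * d)) (hj : j.val % 2 = 1) (z : QPos r d) : adj (pad j) z = false := by
  rw [Bool.eq_false_iff]; intro h
  rcases (adj_eq_true_iff (pad j) z).1 h with ⟨j₀, j', hj₀, -, he, -⟩ | ⟨hne, -, -⟩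
  · cases hj₀; omega
  · exact hne j rfl

end QPos

section Rigidity

variable {r d : ℕ} {M : Fin (2 * half r d) → Fin (2 * half r d)}

/-! ### Forced letters -/

/-- preamble letters are openers -/
theorem lt_pre (hM : M ∈ nestFreeMatchings (2 * half r d)) (hE : ∀ p, p < M p → (p, M p) ∈ allowed r d)
    (j : Fin (2 * r + 1)) : (QPos.pre j).toFin < M (QPos.pre j).toFin :=
  lt_of_no_adj_in hM hE _ fun z => QPos.adj_pre_right z j

/-- frame `U`s are openers -/
theorem lt_frU (hM : M ∈ nestFreeMatchings (2 * half r d)) (hE : ∀ p, p < M p → (p, M p) ∈ allowed r d)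
    (s : Fin r) : (QPos.frU s).toFin < M (QPos.frU s).toFin :=
  lt_of_no_adj_in hM hE _ fun z => QPos.adj_frU_right z s

/-- frame `D`s are closers -/
theorem gt_frD (hM : M ∈ nestFreeMatchings (2 * half r d)) (hE : ∀ p, p < M p → (p, M p) ∈ allowed r d)
    (s : Fin r) : M (QPos.frD s).toFin < (QPos.frD s).toFin :=
  gt_of_no_adj_out hM hE _ fun z => QPos.adj_frD_left s z

/-- postamble letters are closers -/
theorem gt_post (hM : M ∈ nestFreeMatchings (2 * half r d)) (hE : ∀ p, p < M p → (p, M p) ∈ allowed r d)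
    (j : Fin (2 * r + 1)) : M (QPos.post j).toFin < (QPos.post j).toFin :=
  gt_of_no_adj_out hM hE _ fun z => QPos.adj_post_left j z

/-- even padding letters are openers -/
theorem lt_pad (hM : M ∈ nestFreeMatchings (2 * half r d)) (hE : ∀ p, p < M p → (p, M p) ∈ allowed r d)
    (j : Fin (2 * d)) (hj : j.val % 2 = 0) : (QPos.pad j).toFin < M (QPos.pad j).toFin :=
  lt_of_no_adj_in hM hE _ fun z => QPos.adj_pad_even_right z j hj

/-- odd padding letters are closers -/
theorem gt_pad (hM : M ∈ nestFreeMatchings (2 * half r d)) (hE : ∀ p, p < M p → (p, M p) ∈ allowed r d)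
    (j : Fin (2 * d)) (hj : j.val % 2 = 1) : M (QPos.pad j).toFin < (QPos.pad j).toFin :=
  gt_of_no_adj_out hM hE _ fun z => QPos.adj_pad_odd_left j hj z

/-! ### Every window reads `UUDD` or `DDUU` (induction on the stretch) -/

/-- **All windows are design windows**: slot `t` of window `(s, i)` is an opener iff (`t < 2` iff slot `0` is). -/
theorem windows_ok (hM : M ∈ nestFreeMatchings (2 * half r d)) (hE : ∀ p, p < M p → (p, M p) ∈ allowed r d)
    (s i : Fin r) (t : Fin 4) :
    (QPos.slot s i t).toFin < M (QPos.slot s i t).toFin ↔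
      (t.val < 2 ↔ (QPos.slot s i 0).toFin < M (QPos.slot s i 0).toFin) := by
  suffices H : ∀ (n : ℕ) (s : Fin r), s.val = n → ∀ (i : Fin r) (t : Fin 4),
      (QPos.slot s i t).toFin < M (QPos.slot s i t).toFin ↔
        (t.val < 2 ↔ (QPos.slot s i 0).toFin < M (QPos.slot s i 0).toFin) from H _ s rfl i t
  intro n
  induction n with
  | zero =>
    intro s hs i t
    have hi := i.isLt
    -- feeders: preamble letters `2i` (class `(0, i, odd)`) and `2i+1` (class `(0, i+1, even)`)
    refine window_pattern hM hE s i (QPos.pre ⟨2 * i.val, by omega⟩) (QPos.pre ⟨2 * i.val + 1, by omega⟩)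
      (lt_pre hM hE _) ?_ ?_ (lt_pre hM hE _) ?_ ?_ ?_ t
    · refine ⟨?_, ?_, ?_⟩ <;> simp only [QPos.vc_pre] <;> omega
    · intro x _ h1 h2 h3
      have hx := QPos.vc_spec x
      refine QPos.eq_of_vc_eq' ?_ ?_ ?_ <;> simp only [QPos.vc_pre] <;> omega
    · refine ⟨?_, ?_, ?_⟩ <;> simp only [QPos.vc_pre] <;> omega
    · intro x _ h1 h2 h3
      have hx := QPos.vc_spec x
      refine QPos.eq_of_vc_eq' ?_ ?_ ?_ <;> simp only [QPos.vc_pre] <;> omega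
    · simp only [QPos.toNat]; omega
  | succ m ih =>
    intro s hs i t
    have hsr := s.isLt
    have hir := i.isLt
    obtain ⟨s', hs'⟩ : ∃ s' : Fin r, s'.val = m := ⟨⟨m, by omega⟩, rfl⟩
    have ih' := ih s' hs'
    -- feeder `B`: the first push of window `(s', i)`, bit `bB`
    obtain ⟨bB, hbB⟩ : ∃ b : Bool, ((QPos.slot s' i 0).toFin < M (QPos.slot s' i 0).toFin ↔ b = true) :=
      ⟨decide ((QPos.slot s' i 0).toFin < M (QPos.slot s' i 0).toFin), by simp⟩
    have hB : (QPos.slot s' i (QPos.uSlot₁ bB)).toFin < M (QPos.slot s' i (QPos.uSlot₁ bB)).toFin := by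
      rw [ih' i, hbB]
      cases bB <;> simp [QPos.uSlot₁]
    have hBu : ∀ x : QPos r d, x.toFin < M x.toFin → x.vc.1 = s.val → x.vc.2.1 = i.val + 1 → x.vc.2.2 % 2 = 0 →
        x = QPos.slot s' i (QPos.uSlot₁ bB) := by
      intro x hx h1 h2 h3
      have hxs := QPos.eq_slot_of_vc (x := x) (s := s') (i := i) (by omega) h2
      rw [hxs] at hx ⊢
      rw [ih' i, hbB] at hx
      have := (QPos.vc_spec x).1
      congr 1
      apply Fin.ext
      simp only [QPos.uSlot₁_val]
      cases bB <;> simp at hx <;> simp <;> omega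
    by_cases hi0 : i.val = 0
    · -- feeder `A`: the frame `U` of stretch `s'`
      refine window_pattern hM hE s i (QPos.frU s') (QPos.slot s' i (QPos.uSlot₁ bB)) (lt_frU hM hE s') ?_ ?_ hB
        ?_ hBu ?_ t
      · refine ⟨?_, ?_, ?_⟩ <;> simp only [QPos.vc_frU] <;> omega
      · intro x _ h1 h2 h3
        have hx := QPos.vc_spec x
        refine QPos.eq_of_vc_eq' ?_ ?_ ?_ <;> simp only [QPos.vc_frU] <;> omega
      · refine ⟨?_, ?_, ?_⟩ <;> simp only [QPos.vc_slot, QPos.uSlot₁_val] <;> omega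
      · simp only [QPos.toNat]; omega
    · -- feeder `A`: the second push of window `(s', i-1)`, bit `bA`
      obtain ⟨i', hi'⟩ : ∃ i' : Fin r, i'.val + 1 = i.val := ⟨⟨i.val - 1, by omega⟩, by simp; omega⟩
      obtain ⟨bA, hbA⟩ : ∃ b : Bool, ((QPos.slot s' i' 0).toFin < M (QPos.slot s' i' 0).toFin ↔ b = true) :=
        ⟨decide ((QPos.slot s' i' 0).toFin < M (QPos.slot s' i' 0).toFin), by simp⟩
      have hA : (QPos.slot s' i' (QPos.uSlot₂ bA)).toFin < M (QPos.slot s' i' (QPos.uSlot₂ bA)).toFin := by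
        rw [ih' i', hbA]
        cases bA <;> simp [QPos.uSlot₂]
      refine window_pattern hM hE s i (QPos.slot s' i' (QPos.uSlot₂ bA)) (QPos.slot s' i (QPos.uSlot₁ bB)) hA ?_ ?_
        hB ?_ hBu ?_ t
      · refine ⟨?_, ?_, ?_⟩ <;> simp only [QPos.vc_slot, QPos.uSlot₂_val] <;> omega
      · intro x hx h1 h2 h3
        have hxs := QPos.eq_slot_of_vc (x := x) (s := s') (i := i') (by omega) (by omega)
        rw [hxs] at hx ⊢
        rw [ih' i', hbA] at hx
        have := (QPos.vc_spec x).1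
        congr 1
        apply Fin.ext
        simp only [QPos.uSlot₂_val]
        cases bA <;> simp at hx <;> simp <;> omega
      · refine ⟨?_, ?_, ?_⟩ <;> simp only [QPos.vc_slot, QPos.uSlot₁_val] <;> omega
      · simp only [QPos.toNat, QPos.uSlot₂_val, QPos.uSlot₁_val]
        have := Bool.toNat_le (!bA); have := Bool.toNat_le (!bB)
        omega

/-- The bit matrix READ OFF a matching: bit `(s, i)` = [slot `0` of window `(s, i)` is an opener] (`UUDD`). -/
theorem lt_iff_isU_bitsOf (hM : M ∈ nestFreeMatchings (2 * half r d))
    (hE : ∀ p, p < M p → (p, M p) ∈ allowed r d) (x : QPos r d) :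
    x.toFin < M x.toFin ↔
      QPos.isU (fun c : Fin r × Fin r => decide ((QPos.slot c.1 c.2 0).toFin < M (QPos.slot c.1 c.2 0).toFin)) x
        = true := by
  cases x with
  | pre j => simp only [QPos.isU, iff_true]; exact lt_pre hM hE j
  | frU s => simp only [QPos.isU, iff_true]; exact lt_frU hM hE s
  | slot s i t =>
    rw [windows_ok hM hE s i t]
    simp only [QPos.isU]
    cases h : decide ((QPos.slot s i 0).toFin < M (QPos.slot s i 0).toFin) <;>
      simp only [decide_eq_true_eq, decide_eq_false_iff_not] at h <;> simp [h]
  | frD s => simp only [QPos.isU, Bool.false_eq_true, iff_false]; exact lt_asymm (gt_frD hM hE s)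
  | post j => simp only [QPos.isU, Bool.false_eq_true, iff_false]; exact lt_asymm (gt_post hM hE j)
  | pad j =>
    simp only [QPos.isU, decide_eq_true_eq]
    by_cases hj : j.val % 2 = 0
    · exact iff_of_true (lt_pad hM hE j hj) hj
    · exact iff_of_false (lt_asymm (gt_pad hM hE j (by omega))) hj

/-- **RIGIDITY (h3).**  A nest-free perfect matching supported on the allowed arcs of layout B is the design of the bit
matrix read off its windows. -/
theorem design_bitsOf (hM : M ∈ nestFreeMatchings (2 * half r d))
    (hE : ∀ p, p < M p → (p, M p) ∈ allowed r d) :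
    design d (fun c : Fin r × Fin r => decide ((QPos.slot c.1 c.2 0).toFin < M (QPos.slot c.1 c.2 0).toFin)) = M := by
  refine eq_of_forall_lt_iff (design_mem_nestFreeMatchings _) hM fun p => ?_
  obtain ⟨x, rfl⟩ := QPos.exists_toFin_eq p
  rw [toFin_lt_design_iff, lt_iff_isU_bitsOf hM hE]

/-- **RIGIDITY**, existential form: every nest-free perfect matching supported on `allowed r d` is a design. -/
theorem exists_design_eq (M : Fin (2 * half r d) → Fin (2 * half r d)) (hM : M ∈ nestFreeMatchings (2 * half r d))
    (hE : ∀ p, p < M p → (p, M p) ∈ allowed r d) : ∃ X : Fin r × Fin r → Bool, design d X = M :=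
  ⟨_, design_bitsOf hM hE⟩

end Rigidity

end Summit.ValiantsHypothesis.ValiantsHypothesis.Theorems.FifoMatching.NFPolytopeQuasiPolyXC.QueueGridFace

end
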